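import Mathlib
import Summits.ResolutionOfSingularities.ResolutionOfSingularities.Theorems.RadicialJungCleanModelsCleanProp44DescentAtBirth
import HarnessLib

/-!
# Route `RadicialJung`, crux `CleanModels` (stmt-ResolutionOfSingularities-15917), line `Sketch` rev 35, stub 6 `stub_cleanProp44` (X44c):
# THE TRANSFER HYPOTHESES OF ✓ `descent_at_birth` FROM «UNRAMIFIED WITH THE SAME RESIDUE FIELD» — density modulo `𝔫^m` and order detection, def-free

Seat decomp-res-hand-2 g21 (structural hand).  ✓ `descent_at_birth` / ✓ `birth_descent_of_face` (`…DescentAtBirth`, `…BirthDescentOfFace`) transfer the birth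
order from the curve `K = L′_rep ∩ E` to the base line `𝔸¹_u = Spec κ(c)[u]` through two hypotheses on the projection `ρ : κ[u] → D` (`D = 𝒪_{K,c′}`, a DVR):
(dense) every `x ∈ D` is a polynomial modulo `𝔫^m`; (ord) `ρ(h) ∈ 𝔫^m ⟹ P^m ∣ h`.  Memo 4e §2.5 uses them silently («`Γ″ ≅ Z_{δ−2} ≅ ℙ¹_{κ(c)}`», the curve
`K` is the graph `t_m = G^p/v(c)` over the `u`-line).  THIS FILE derives BOTH, for every `m`, from the two first-order facts the scheme side (census (S)) naturally
delivers for a curve étale over the base at a point with trivial residue extension: `𝔫 = ρ(P)·D` (`P` — the closed point `c′ ↦ P` of the base line, a prime of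
`κ[u]` — is a UNIFORMIZER of `D`: unramified) and `D = ρ(κ[u]) + 𝔫` (the SAME RESIDUE FIELD).

* `comap_maximalIdeal_eq_span` — `ρ⁻¹(𝔫) = (P)` (a non-zero prime of the PID `κ[u]` is maximal); `isUnit_map_of_not_dvd` — `P ∤ w ⟹ ρ(w) ∈ D^×`.
* `mem_span_pow_of_map_mem_pow` — **(ord)**: `ρ(h) ∈ 𝔫^m ⟹ h ∈ (P)^m`, every `m`.
* `exists_sub_map_mem_pow` — **(dense)**: `∀ m x, ∃ g ∈ κ[u], x − ρ(g) ∈ 𝔫^m`.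
* `transfer_of_unramified` — both, in the exact shape consumed by ✓ `descent_at_birth` (with `D = S/I`, `𝔫 = 𝔪̄ = maximalIdeal`, ✓ `map_mk_eq_maximalIdeal_of_isMaximal`),
  and `descent_at_birth_of_unramified` — ✓ `descent_at_birth` with (dense)/(ord) replaced by «`P` uniformizes `S/I` and the residue field is `κ[u]/(P)`».

Honest framing: OURS, elementary commutative algebra; producing `𝔫 = (ρ P)` and the residue surjection from the tree's blowings up is census (S); nothing here proves
X44c, any case of `CleanModels`, or resolution of singularities in characteristic `p`. [cite: Matsumura1987, Thm. 11.1–11.2 (discrete valuation rings)]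
[cite: CossartPiltant2008, Prop. 4.4 (proof, p. 11)]
-/

noncomputable section

set_option linter.dupNamespace false -- mandated namespace of this single-conjunct summit

open Polynomial IsLocalRing

namespace Summit.ResolutionOfSingularities.ResolutionOfSingularities.Theorems.RadicialJung.CleanModels

section Transfer

variable {k : Type*} [Field k] {D : Type*} [CommRing D] [IsDomain D] [IsDiscreteValuationRing D] (ρ : k[X] →+* D) {P : k[X]}

/-- **`ρ⁻¹(𝔫) = (P)`**: if the prime `P` of `κ[u]` generates the maximal ideal of the DVR `D` through `ρ`, then the contraction of `𝔫` is `(P)` (it is a proper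
prime containing the maximal ideal `(P)`). [folklore] -/
theorem comap_maximalIdeal_eq_span (hP : Prime P) (hunif : maximalIdeal D = Ideal.span {ρ P}) :
    (maximalIdeal D).comap ρ = Ideal.span {P} := by
  have hle : Ideal.span {P} ≤ (maximalIdeal D).comap ρ := by
    rw [Ideal.span_singleton_le_iff_mem, Ideal.mem_comap, hunif]
    exact Ideal.mem_span_singleton_self _
  haveI : (Ideal.span {P}).IsPrime := (Ideal.span_singleton_prime hP.ne_zero).mpr hP
  have hmax : (Ideal.span {P}).IsMaximal :=
    IsPrime.to_maximal_ideal (by rw [Ne, Ideal.span_singleton_eq_bot]; exact hP.ne_zero)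
  exact (hmax.eq_of_le (Ideal.IsPrime.ne_top inferInstance) hle).symm

/-- `P ∤ w ⟹ ρ(w)` is a unit of `D`. [folklore] -/
theorem isUnit_map_of_not_dvd (hP : Prime P) (hunif : maximalIdeal D = Ideal.span {ρ P}) {w : k[X]} (hw : ¬ P ∣ w) :
    IsUnit (ρ w) := by
  by_contra hu
  have h1 : w ∈ (maximalIdeal D).comap ρ := by
    rw [Ideal.mem_comap]; exact hu
  rw [comap_maximalIdeal_eq_span ρ hP hunif, Ideal.mem_span_singleton] at h1
  exact hw h1

/-- The uniformizer `ρ(P)` is non-zero (a DVR is not a field). [folklore] -/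
theorem map_ne_zero_of_unif (hunif : maximalIdeal D = Ideal.span {ρ P}) : ρ P ≠ 0 := by
  intro h0
  apply IsDiscreteValuationRing.not_a_field D
  rw [hunif, h0, Ideal.span_singleton_eq_bot]

/-- **(ord) `ρ(h) ∈ 𝔫^m ⟹ h ∈ (P)^m`**, for every `m` (induction: cancel one `ρ(P)` at a time in the domain `D`). [cite: Matsumura1987, Thm. 11.1] -/
theorem mem_span_pow_of_map_mem_pow (hP : Prime P) (hunif : maximalIdeal D = Ideal.span {ρ P}) :
    ∀ (m : ℕ) (h : k[X]), ρ h ∈ maximalIdeal D ^ m → h ∈ Ideal.span {P} ^ m := by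
  intro m
  induction m with
  | zero => intro h _; simp
  | succ m ih =>
    intro h hh
    have hm : h ∈ Ideal.span {P} ^ m := ih h (Ideal.pow_le_pow_right (Nat.le_succ m) hh)
    rw [Ideal.span_singleton_pow, Ideal.mem_span_singleton] at hm
    obtain ⟨h₁, rfl⟩ := hm
    -- `ρ(P)^m ρ(h₁) ∈ (ρ P)^{m+1}` ⟹ `ρ h₁ ∈ (ρ P)`
    rw [hunif, Ideal.span_singleton_pow, Ideal.mem_span_singleton, map_mul, map_pow, pow_succ] at hh
    obtain ⟨y, hy⟩ := hh
    have h2 : ρ h₁ = ρ P * y := by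
      have h3 : ρ P ^ m * ρ h₁ = ρ P ^ m * (ρ P * y) := by rw [hy, mul_assoc]
      exact mul_left_cancel₀ (pow_ne_zero m (map_ne_zero_of_unif ρ hunif)) h3
    have h4 : h₁ ∈ (maximalIdeal D).comap ρ := by
      rw [Ideal.mem_comap, hunif, Ideal.mem_span_singleton]; exact ⟨y, h2⟩
    rw [comap_maximalIdeal_eq_span ρ hP hunif, Ideal.mem_span_singleton] at h4
    obtain ⟨h₂, rfl⟩ := h4
    rw [Ideal.span_singleton_pow, Ideal.mem_span_singleton, pow_succ]
    exact mul_dvd_mul_left _ (dvd_mul_right P h₂)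

/-- **(dense) every element of `D` is a polynomial modulo `𝔫^m`**, for every `m`, from the residue surjection `D = ρ(κ[u]) + 𝔫` and the uniformizer `ρ(P)`.
[cite: Matsumura1987, Thm. 11.2] -/
theorem exists_sub_map_mem_pow (hunif : maximalIdeal D = Ideal.span {ρ P}) (hres : ∀ y : D, ∃ g : k[X], y - ρ g ∈ maximalIdeal D) :
    ∀ (m : ℕ) (x : D), ∃ g : k[X], x - ρ g ∈ maximalIdeal D ^ m := by
  intro m
  induction m with
  | zero => intro x; exact ⟨0, by simp⟩
  | succ m ih =>
    intro x
    obtain ⟨g, hg⟩ := ih x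
    rw [hunif, Ideal.span_singleton_pow, Ideal.mem_span_singleton] at hg
    obtain ⟨y, hy⟩ := hg
    obtain ⟨g₁, hg₁⟩ := hres y
    refine ⟨g + P ^ m * g₁, ?_⟩
    have h1 : x - ρ (g + P ^ m * g₁) = ρ P ^ m * (y - ρ g₁) := by
      rw [map_add, map_mul, map_pow, ← sub_sub, hy]; ring
    rw [h1, pow_succ]
    refine Ideal.mul_mem_mul ?_ hg₁
    rw [hunif, Ideal.span_singleton_pow]
    exact Ideal.mem_span_singleton_self _

/-- **PACKAGED** for ✓ `descent_at_birth`: from «`P` uniformizes `D` through `ρ`» and «same residue field», the two transfer hypotheses at every order `m`.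
[cite: Matsumura1987, Thm. 11.1–11.2] -/
theorem transfer_of_unramified (hP : Prime P) (hunif : maximalIdeal D = Ideal.span {ρ P})
    (hres : ∀ y : D, ∃ g : k[X], y - ρ g ∈ maximalIdeal D) (m : ℕ) :
    (∀ x : D, ∃ g : k[X], x - ρ g ∈ maximalIdeal D ^ m) ∧
      ∀ h : k[X], ρ h ∈ maximalIdeal D ^ m → h ∈ Ideal.span {P} ^ m :=
  ⟨exists_sub_map_mem_pow ρ hunif hres m, mem_span_pow_of_map_mem_pow ρ hP hunif m⟩

end Transfer

/-! ## ✓ `descent_at_birth` with the transfer hypotheses discharged -/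

section Birth

variable {k : Type*} [Field k] {S : Type*} [CommRing S] [Algebra (k[X])[X] S]
  (I : Ideal S) [I.IsPrime] [IsDiscreteValuationRing (S ⧸ I)] (𝔪 : Ideal S) [𝔪.IsMaximal]

/-- **THE DESCENT AT ONE BIRTH, «unramified» form**: ✓ `descent_at_birth` where (dense)/(ord) are replaced by: the closed point `P` of the base line (a prime of
`κ[u]`) UNIFORMIZES the DVR `S/I` through `ρ = (S → S/I) ∘ (κ[u][T] → S) ∘ C`, and every residue class of `S/I` is represented by a polynomial in `u`.
[cite: CossartPiltant2008, Prop. 4.4 (proof, p. 11)] [cite: Matsumura1987, Thm. 11.1–11.2] -/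
theorem descent_at_birth_of_unramified (hI : I ≤ 𝔪) (p : ℕ) [Fact p.Prime] [CharP k p] [CharP (S ⧸ I) p] {c : k} (hc : c ≠ 0)
    (a₀ : k) (lam : k[X]) {μ d' : ℕ} (hμ : 0 < μ) {G : S} (hw : algebraMap (k[X])[X] S (C (C a₀) * X) - G ^ p ∈ I)
    (hf : algebraMap (k[X])[X] S (C (C c) * (X + C lam) ^ μ) ∈ I ⊔ 𝔪 ^ (μ * d')) {P : k[X]} (hP : Prime P)
    (hunif : maximalIdeal (S ⧸ I) =
      Ideal.span {((Ideal.Quotient.mk I).comp ((algebraMap (k[X])[X] S).comp C)) P})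
    (hres : ∀ y : S ⧸ I, ∃ g : k[X], y - ((Ideal.Quotient.mk I).comp ((algebraMap (k[X])[X] S).comp C)) g ∈ maximalIdeal (S ⧸ I)) :
    ∃ g : k[X], C (-a₀) * lam * 1 ^ p + (-g) ^ p ∈ Ideal.span {P} ^ d' := by
  have h𝔪 : 𝔪.map (Ideal.Quotient.mk I) = maximalIdeal (S ⧸ I) := map_mk_eq_maximalIdeal_of_isMaximal I 𝔪 hI
  obtain ⟨hdense, hord⟩ := transfer_of_unramified _ hP hunif hres d'
  refine descent_at_birth I 𝔪 hI p hc a₀ lam hμ hw hf (fun x => ?_) (P := P) (fun h hh => hord h ?_)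
  · obtain ⟨g, hg⟩ := hdense x
    exact ⟨g, by rw [h𝔪]; exact hg⟩
  · rw [h𝔪] at hh; exact hh

end Birth

end Summit.ResolutionOfSingularities.ResolutionOfSingularities.Theorems.RadicialJung.CleanModels

end
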